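import Mathlib
import HarnessLib

/-!
# Kernel point counts for the paramodularity certificates — the finite fields `𝔽_{p²}` used

The sibling files `KernelCounts277.lean`, `…349`, `…353`, `…461`, `…587minus`, `…587plus` count points of the
certificate curves over `𝔽_p = ZMod p` and over `𝔽_{p²}`, the latter realised as Mathlib's
`QuadraticAlgebra (ZMod p) a b` (pairs `re + im·t` with `t² = a + b·t`) with the `Fintype` structure transported
along `QuadraticAlgebra.equivProd`.  This file records, for each pair `(p; a, b)` used there —
`(2; 1, 1)`, `(3; 2, 0)`, `(3; 1, 2)`, `(5; 2, 0)`, `(7; 3, 0)`, `(11; 2, 0)`, `(13; 2, 0)` — that `t² = a + b·t` has no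
root in `𝔽_p` (by `decide`), hence (Mathlib's `QuadraticAlgebra.instField`) the algebra is a FIELD, and that it
has `p²` elements: so it is a finite field of order `p²`, i.e. a model of `𝔽_{p²}`, and the sibling files' counts are
point counts over `𝔽_{p²}`.  `(3; 1, 2)` is the presentation `𝔽₉ = 𝔽₃[z]/(z² + z + 2)` used by the `N = 587⁺`
certificate's cluster-picture chart at `p = 3`.  Nothing here is specific to the curves. [folklore]
-/

namespace Literature.NumberTheory.FaltingsSerre.KernelCounts.Fields

/-- `t² = 1 + 1·t` has no root in `𝔽_2` (so `QuadraticAlgebra (ZMod 2) 1 1` is a field, `isField_F4`). [folklore] -/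
theorem irreducible_F4 : ∀ r : ZMod 2, r ^ 2 ≠ 1 + 1 * r := by decide

/-- `QuadraticAlgebra (ZMod 2) 1 1` has `4` elements. [folklore] -/
theorem card_F4 : Nat.card (QuadraticAlgebra (ZMod 2) 1 1) = 4 := by
  rw [Nat.card_congr (QuadraticAlgebra.equivProd (1 : ZMod 2) 1), Nat.card_prod, Nat.card_zmod]

/-- `QuadraticAlgebra (ZMod 2) 1 1` is a field (Mathlib's instance, from the `Fact` `irreducible_F4`): with `card_F4`, a finite field of
order `4`, i.e. a model of `𝔽_4`. [folklore] -/
theorem isField_F4 : IsField (QuadraticAlgebra (ZMod 2) 1 1) := by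
  haveI : Fact (Nat.Prime 2) := ⟨by norm_num⟩
  haveI : Fact (∀ r : ZMod 2, r ^ 2 ≠ 1 + 1 * r) := ⟨irreducible_F4⟩
  exact Field.toIsField (QuadraticAlgebra (ZMod 2) 1 1)

/-- `t² = 2` has no root in `𝔽_3` (so `QuadraticAlgebra (ZMod 3) 2 0` is a field, `isField_F9`). [folklore] -/
theorem irreducible_F9 : ∀ r : ZMod 3, r ^ 2 ≠ 2 + 0 * r := by decide

/-- `QuadraticAlgebra (ZMod 3) 2 0` has `9` elements. [folklore] -/
theorem card_F9 : Nat.card (QuadraticAlgebra (ZMod 3) 2 0) = 9 := by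
  rw [Nat.card_congr (QuadraticAlgebra.equivProd (2 : ZMod 3) 0), Nat.card_prod, Nat.card_zmod]

/-- `QuadraticAlgebra (ZMod 3) 2 0` is a field (Mathlib's instance, from the `Fact` `irreducible_F9`): with `card_F9`, a finite field of
order `9`, i.e. a model of `𝔽_9`. [folklore] -/
theorem isField_F9 : IsField (QuadraticAlgebra (ZMod 3) 2 0) := by
  haveI : Fact (Nat.Prime 3) := ⟨by norm_num⟩
  haveI : Fact (∀ r : ZMod 3, r ^ 2 ≠ 2 + 0 * r) := ⟨irreducible_F9⟩
  exact Field.toIsField (QuadraticAlgebra (ZMod 3) 2 0)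

/-- `t² = 1 + 2·t` has no root in `𝔽_3` (so `QuadraticAlgebra (ZMod 3) 1 2` is a field, `isField_F9b`). [folklore] -/
theorem irreducible_F9b : ∀ r : ZMod 3, r ^ 2 ≠ 1 + 2 * r := by decide

/-- `QuadraticAlgebra (ZMod 3) 1 2` has `9` elements. [folklore] -/
theorem card_F9b : Nat.card (QuadraticAlgebra (ZMod 3) 1 2) = 9 := by
  rw [Nat.card_congr (QuadraticAlgebra.equivProd (1 : ZMod 3) 2), Nat.card_prod, Nat.card_zmod]

/-- `QuadraticAlgebra (ZMod 3) 1 2` is a field (Mathlib's instance, from the `Fact` `irreducible_F9b`): with `card_F9b`, a finite field of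
order `9`, i.e. a model of `𝔽_9`. [folklore] -/
theorem isField_F9b : IsField (QuadraticAlgebra (ZMod 3) 1 2) := by
  haveI : Fact (Nat.Prime 3) := ⟨by norm_num⟩
  haveI : Fact (∀ r : ZMod 3, r ^ 2 ≠ 1 + 2 * r) := ⟨irreducible_F9b⟩
  exact Field.toIsField (QuadraticAlgebra (ZMod 3) 1 2)

/-- `t² = 2` has no root in `𝔽_5` (so `QuadraticAlgebra (ZMod 5) 2 0` is a field, `isField_F25`). [folklore] -/
theorem irreducible_F25 : ∀ r : ZMod 5, r ^ 2 ≠ 2 + 0 * r := by decide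

/-- `QuadraticAlgebra (ZMod 5) 2 0` has `25` elements. [folklore] -/
theorem card_F25 : Nat.card (QuadraticAlgebra (ZMod 5) 2 0) = 25 := by
  rw [Nat.card_congr (QuadraticAlgebra.equivProd (2 : ZMod 5) 0), Nat.card_prod, Nat.card_zmod]

/-- `QuadraticAlgebra (ZMod 5) 2 0` is a field (Mathlib's instance, from the `Fact` `irreducible_F25`): with `card_F25`, a finite field of
order `25`, i.e. a model of `𝔽_25`. [folklore] -/
theorem isField_F25 : IsField (QuadraticAlgebra (ZMod 5) 2 0) := by
  haveI : Fact (Nat.Prime 5) := ⟨by norm_num⟩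
  haveI : Fact (∀ r : ZMod 5, r ^ 2 ≠ 2 + 0 * r) := ⟨irreducible_F25⟩
  exact Field.toIsField (QuadraticAlgebra (ZMod 5) 2 0)

/-- `t² = 3` has no root in `𝔽_7` (so `QuadraticAlgebra (ZMod 7) 3 0` is a field, `isField_F49`). [folklore] -/
theorem irreducible_F49 : ∀ r : ZMod 7, r ^ 2 ≠ 3 + 0 * r := by decide

/-- `QuadraticAlgebra (ZMod 7) 3 0` has `49` elements. [folklore] -/
theorem card_F49 : Nat.card (QuadraticAlgebra (ZMod 7) 3 0) = 49 := by
  rw [Nat.card_congr (QuadraticAlgebra.equivProd (3 : ZMod 7) 0), Nat.card_prod, Nat.card_zmod]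

/-- `QuadraticAlgebra (ZMod 7) 3 0` is a field (Mathlib's instance, from the `Fact` `irreducible_F49`): with `card_F49`, a finite field of
order `49`, i.e. a model of `𝔽_49`. [folklore] -/
theorem isField_F49 : IsField (QuadraticAlgebra (ZMod 7) 3 0) := by
  haveI : Fact (Nat.Prime 7) := ⟨by norm_num⟩
  haveI : Fact (∀ r : ZMod 7, r ^ 2 ≠ 3 + 0 * r) := ⟨irreducible_F49⟩
  exact Field.toIsField (QuadraticAlgebra (ZMod 7) 3 0)

/-- `t² = 2` has no root in `𝔽_11` (so `QuadraticAlgebra (ZMod 11) 2 0` is a field, `isField_F121`). [folklore] -/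
theorem irreducible_F121 : ∀ r : ZMod 11, r ^ 2 ≠ 2 + 0 * r := by decide

/-- `QuadraticAlgebra (ZMod 11) 2 0` has `121` elements. [folklore] -/
theorem card_F121 : Nat.card (QuadraticAlgebra (ZMod 11) 2 0) = 121 := by
  rw [Nat.card_congr (QuadraticAlgebra.equivProd (2 : ZMod 11) 0), Nat.card_prod, Nat.card_zmod]

/-- `QuadraticAlgebra (ZMod 11) 2 0` is a field (Mathlib's instance, from the `Fact` `irreducible_F121`): with `card_F121`, a finite field of
order `121`, i.e. a model of `𝔽_121`. [folklore] -/
theorem isField_F121 : IsField (QuadraticAlgebra (ZMod 11) 2 0) := by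
  haveI : Fact (Nat.Prime 11) := ⟨by norm_num⟩
  haveI : Fact (∀ r : ZMod 11, r ^ 2 ≠ 2 + 0 * r) := ⟨irreducible_F121⟩
  exact Field.toIsField (QuadraticAlgebra (ZMod 11) 2 0)

/-- `t² = 2` has no root in `𝔽_13` (so `QuadraticAlgebra (ZMod 13) 2 0` is a field, `isField_F169`). [folklore] -/
theorem irreducible_F169 : ∀ r : ZMod 13, r ^ 2 ≠ 2 + 0 * r := by decide

/-- `QuadraticAlgebra (ZMod 13) 2 0` has `169` elements. [folklore] -/
theorem card_F169 : Nat.card (QuadraticAlgebra (ZMod 13) 2 0) = 169 := by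
  rw [Nat.card_congr (QuadraticAlgebra.equivProd (2 : ZMod 13) 0), Nat.card_prod, Nat.card_zmod]

/-- `QuadraticAlgebra (ZMod 13) 2 0` is a field (Mathlib's instance, from the `Fact` `irreducible_F169`): with `card_F169`, a finite field of
order `169`, i.e. a model of `𝔽_169`. [folklore] -/
theorem isField_F169 : IsField (QuadraticAlgebra (ZMod 13) 2 0) := by
  haveI : Fact (Nat.Prime 13) := ⟨by norm_num⟩
  haveI : Fact (∀ r : ZMod 13, r ^ 2 ≠ 2 + 0 * r) := ⟨irreducible_F169⟩
  exact Field.toIsField (QuadraticAlgebra (ZMod 13) 2 0)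

end Literature.NumberTheory.FaltingsSerre.KernelCounts.Fields
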